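import Summits.CriticalPhenomena.PercolationContinuityZ3.Theorems.PercNearOneGluingNoHeavyLowerTailStarSetResidualFacts
import HarnessLib

/-!
# `NoHeavyLowerTail` (stmt-CriticalPhenomena-4575) — the residual ledger, Ib: the r-class word families are disjoint (U1-PROOF.md §9)

Support file (prover `prim-gen-swap` gen 15; `--supports stmt-CriticalPhenomena-4575`).  No definitions, no named facts, no sorries.

Five word families of the residual bound are filed under class-sets containing a class through `r`, each with coefficient `1`:
the R1-rider words `{X, I₀, ρ}`, the SELF words `{X, J, dom X ē}` and the flagged SELF′ words `{X, J, I₀}` of the group units, the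
SELF_I words `{X, I₀, dom X a}` and the CROSS_I words `{X, Y, I₀}` of the `I₀`-units.  This file shows that the five families of
class-sets are pairwise disjoint (ten pairs), from the unit data (`StarSet.residual_unit_facts`) — here the six pairs
among the SELF / SELF′ / SELF_I / CROSS_I families; part Ia has the four pairs with the R1-rider family.

* `StarSet.residual_rwords_disjoint_pool`.
-/

namespace Summit.CriticalPhenomena.PercolationContinuityZ3.Theorems

open Finset
open scoped BigOperators Classical

namespace StarSet

variable {ι V : Type*} [LinearOrder ι] [DecidableEq V]

/-- **The SELF / SELF′ / SELF_I / CROSS_I class-sets are pairwise disjoint.**  See the file header. -/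
theorem residual_rwords_disjoint_pool (P P' : ι → V) (hPP' : ∀ X, P X ≠ P' X)
    (hinj : Function.Injective fun X => (s(P X, P' X) : Sym2 V)) (r : V) (F : Finset ι)
    (dom : ι → V → ι)
    (hdom : ∀ X ∉ F, ∀ d, (P X = d ∨ P' X = d) →
      dom X d ∈ F ∧ (P (dom X d) = d ∨ P' (dom X d) = d) ∧
        (∀ u, (P (dom X d) = u ∨ P' (dom X d) = u) → (P X = u ∨ P' X = u) → u = d))
    (I₀ : ι) (hleaf : ∀ I ∈ F, P' I = r → I = I₀) (hI₀r : I₀ ∈ F → P' I₀ = r)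
    (U : Finset (Finset ι × ι)) (Jf : Finset ι × ι → ι) (ef ēf : Finset ι × ι → V) (ρf : Finset ι × ι → ι)
    (hdata : (∀ u ∈ U, u.2 ∈ u.1 ∧ u.2 ∉ F ∧ (P u.2 ≠ r ∧ P' u.2 ≠ r) ∧
      (∀ Y ∈ u.1, P Y = P u.2 ∨ P Y = P' u.2 ∨ P' Y = P u.2 ∨ P' Y = P' u.2) ∧
      ¬ ((∀ I ∈ F, I ∉ u.1) ∨ ∃ a ∈ F, P a = r ∧ a ∈ u.1 ∧ ∀ b ∈ F, b < a → b ∉ u.1) ∧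
      Jf u ∈ u.1 ∧ Jf u ∈ F ∧ (∀ I ∈ u.1, I ∈ F → Jf u ≤ I) ∧ P (Jf u) ≠ r ∧
      ((P u.2 = ef u ∧ P' u.2 = ēf u) ∨ (P u.2 = ēf u ∧ P' u.2 = ef u)) ∧ (P (Jf u) = ef u ∨ P' (Jf u) = ef u) ∧
      ¬ (P (Jf u) = ēf u ∨ P' (Jf u) = ēf u) ∧
      ((P (Jf u) = ef u ∧ P' (Jf u) = r ∧ P (dom u.2 (ēf u)) ≠ r ∧ P' (dom u.2 (ēf u)) ≠ r) ∨
       (P (Jf u) ≠ r ∧ P' (Jf u) ≠ r ∧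
        ((P (dom u.2 (ēf u)) = r ∧ P' (dom u.2 (ēf u)) = ēf u ∧ Jf u < dom u.2 (ēf u)) ∨
         (P (dom u.2 (ēf u)) = ēf u ∧ P' (dom u.2 (ēf u)) = r)))) ∧
      (∀ Y ∈ u.1, Y ≠ u.2 → (P Y ≠ r ∧ P' Y ≠ r) → ∀ p, (P u.2 = p ∨ P' u.2 = p) → (P Y ≠ p ∧ P' Y ≠ p) →
        (P (dom u.2 p) = r ∨ P' (dom u.2 p) = r))))
    (hρ : (∀ u ∈ U, (((u.1.erase u.2).erase (Jf u)).filter (fun K => (P K ≠ r ∧ P' K ≠ r) ∧ K ≠ dom u.2 (ēf u))).Nonempty → ρf u ∈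
        (((u.1.erase u.2).erase (Jf u)).filter (fun K => (P K ≠ r ∧ P' K ≠ r) ∧ K ≠ dom u.2 (ēf u)))))
    (UG UC UH : Finset (Finset ι × ι))
    (hUG : UG = U.filter (fun u => ¬ (P (Jf u) = ef u ∧ P' (Jf u) = r) ∧ ¬ (¬ (P (Jf u) = ef u ∧ P' (Jf u) = r) ∧ dom u.2 (ef u) ≠ Jf u ∧ (P (dom
        u.2 (ef u)) ≠ r ∧ P' (dom u.2 (ef u)) ≠ r)) ∧ ¬ (((u.1.erase u.2).erase (Jf u)).filter (fun K => (P K ≠ r ∧ P' K ≠ r) ∧ K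
        ≠ dom u.2 (ēf u))).Nonempty ∧ ¬ (P' (dom u.2 (ēf u)) = r ∧ Jf u = dom u.2 (ef u))))
    (hUC : UC = U.filter (fun u => (P (Jf u) = ef u ∧ P' (Jf u) = r) ∧ ¬ (((u.1.erase u.2).erase (Jf u)).filter (fun K => (P K ≠ r ∧ P' K ≠ r) ∧ K
        ≠ dom u.2 (ēf u))).Nonempty ∧ dom u.2 (ef u) ≠ Jf u))
    (hUH : UH = U.filter (fun u => ¬ (((u.1.erase u.2).erase (Jf u)).filter (fun K => (P K ≠ r ∧ P' K ≠ r) ∧ K ≠ dom u.2 (ēf u))).Nonempty ∧ (((P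
        (Jf u) = ef u ∧ P' (Jf u) = r) ∧ dom u.2 (ef u) = Jf u) ∨ (¬ (P (Jf u) = ef u ∧ P' (Jf u) = r) ∧ ¬ (¬ (P (Jf u) = ef u ∧
        P' (Jf u) = r) ∧ dom u.2 (ef u) ≠ Jf u ∧ (P (dom u.2 (ef u)) ≠ r ∧ P' (dom u.2 (ef u)) ≠ r)) ∧ (P' (dom u.2 (ēf u)) = r ∧
        Jf u = dom u.2 (ef u)))))) :
    Disjoint (UG.image (fun u => ({u.2, Jf u, dom u.2 (ēf u)} : Finset ι)))
      ((UG.filter (fun u => (((P u.2 = P I₀ ∨ P' u.2 = P I₀) ∧ I₀ ∈ F ∧ P' I₀ = r) ∧ dom u.2 (ēf u) ≠ I₀))).image (fun u => ({u.2, Jf u, I₀} : Finset ι))) ∧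
    Disjoint (UG.image (fun u => ({u.2, Jf u, dom u.2 (ēf u)} : Finset ι)))
      ((UC ∪ UH).image (fun u => ({u.2, I₀, dom u.2 (if P u.2 = P I₀ then P' u.2 else P u.2)} : Finset ι))) ∧
    Disjoint (UG.image (fun u => ({u.2, Jf u, dom u.2 (ēf u)} : Finset ι)))
      ((((UC ∪ UH).image Prod.snd ×ˢ (UC ∪ UH).image Prod.snd).filter (fun p => p.1 < p.2)).image (fun p => ({p.1, p.2, I₀} : Finset ι))) ∧
    Disjoint ((UG.filter (fun u => (((P u.2 = P I₀ ∨ P' u.2 = P I₀) ∧ I₀ ∈ F ∧ P' I₀ = r) ∧ dom u.2 (ēf u) ≠ I₀))).image (fun u => ({u.2, Jf u, I₀} : Finset ι)))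
      ((UC ∪ UH).image (fun u => ({u.2, I₀, dom u.2 (if P u.2 = P I₀ then P' u.2 else P u.2)} : Finset ι))) ∧
    Disjoint ((UG.filter (fun u => (((P u.2 = P I₀ ∨ P' u.2 = P I₀) ∧ I₀ ∈ F ∧ P' I₀ = r) ∧ dom u.2 (ēf u) ≠ I₀))).image (fun u => ({u.2, Jf u, I₀} : Finset ι)))
      ((((UC ∪ UH).image Prod.snd ×ˢ (UC ∪ UH).image Prod.snd).filter (fun p => p.1 < p.2)).image (fun p => ({p.1, p.2, I₀} : Finset ι))) ∧
    Disjoint ((UC ∪ UH).image (fun u => ({u.2, I₀, dom u.2 (if P u.2 = P I₀ then P' u.2 else P u.2)} : Finset ι)))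
      ((((UC ∪ UH).image Prod.snd ×ˢ (UC ∪ UH).image Prod.snd).filter (fun p => p.1 < p.2)).image (fun p => ({p.1, p.2, I₀} : Finset ι))) := by
  have facts := residual_unit_facts P P' hPP' hinj r F dom hdom I₀ hleaf hI₀r U Jf ef ēf ρf hdata hρ
  -- ports of a hub
  have hports : ∀ u ∈ U, ∀ x, (P u.2 = x ∨ P' u.2 = x) → x = ef u ∨ x = ēf u := by
    intro u hu x hx
    obtain ⟨-, -, -, -, -, -, -, -, -, hX, -⟩ := hdata u hu
    rcases hX with ⟨h1, h2⟩ | ⟨h1, h2⟩ <;> rcases hx with h | h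
    · exact Or.inl (h.symm.trans h1)
    · exact Or.inr (h.symm.trans h2)
    · exact Or.inr (h.symm.trans h1)
    · exact Or.inl (h.symm.trans h2)
  -- the elements of the five families
  have hA2 : ∀ T ∈ UG.image (fun u => ({u.2, Jf u, dom u.2 (ēf u)} : Finset ι)), ∃ v ∈ U,
      ¬ (P (Jf v) = ef v ∧ P' (Jf v) = r) ∧
      ¬ (¬ (P (Jf v) = ef v ∧ P' (Jf v) = r) ∧ dom v.2 (ef v) ≠ Jf v ∧ (P (dom v.2 (ef v)) ≠ r ∧ P' (dom v.2 (ef v)) ≠ r)) ∧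
      ¬ (P' (dom v.2 (ēf v)) = r ∧ Jf v = dom v.2 (ef v)) ∧ T = {v.2, Jf v, dom v.2 (ēf v)} := by
    intro T hT
    obtain ⟨v, hv, rfl⟩ := mem_image.1 hT
    rw [hUG, mem_filter] at hv
    exact ⟨v, hv.1, hv.2.1, hv.2.2.1, hv.2.2.2.2, rfl⟩
  have hA3 : ∀ T ∈ (UG.filter (fun u => (((P u.2 = P I₀ ∨ P' u.2 = P I₀) ∧ I₀ ∈ F ∧ P' I₀ = r) ∧ dom u.2 (ēf u) ≠ I₀))).image
      (fun u => ({u.2, Jf u, I₀} : Finset ι)), ∃ v ∈ U,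
      ¬ (P (Jf v) = ef v ∧ P' (Jf v) = r) ∧
      (((P v.2 = P I₀ ∨ P' v.2 = P I₀) ∧ I₀ ∈ F ∧ P' I₀ = r) ∧ dom v.2 (ēf v) ≠ I₀) ∧ T = {v.2, Jf v, I₀} := by
    intro T hT
    obtain ⟨v, hv, rfl⟩ := mem_image.1 hT
    rw [mem_filter, hUG, mem_filter] at hv
    exact ⟨v, hv.1.1, hv.1.2.1, hv.2, rfl⟩
  have hI : ∀ w ∈ UC ∪ UH, w ∈ U ∧ w.2 ∉ F ∧ (P w.2 = P I₀ ∨ P' w.2 = P I₀) ∧ I₀ ∈ F ∧ P' I₀ = r ∧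
      dom w.2 (if P w.2 = P I₀ then P' w.2 else P w.2) ∈ F ∧
      (P (dom w.2 (if P w.2 = P I₀ then P' w.2 else P w.2)) = (if P w.2 = P I₀ then P' w.2 else P w.2) ∨
        P' (dom w.2 (if P w.2 = P I₀ then P' w.2 else P w.2)) = (if P w.2 = P I₀ then P' w.2 else P w.2)) ∧
      (P (dom w.2 (if P w.2 = P I₀ then P' w.2 else P w.2)) ≠ r ∧ P' (dom w.2 (if P w.2 = P I₀ then P' w.2 else P w.2)) ≠ r) ∧
      (P w.2 = (if P w.2 = P I₀ then P' w.2 else P w.2) ∨ P' w.2 = (if P w.2 = P I₀ then P' w.2 else P w.2)) ∧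
      (if P w.2 = P I₀ then P' w.2 else P w.2) ≠ P I₀ := by
    intro w hw
    have hlast : ∀ X, (P X = P I₀ ∨ P' X = P I₀) → (P X = (if P X = P I₀ then P' X else P X) ∨
        P' X = (if P X = P I₀ then P' X else P X)) ∧ (if P X = P I₀ then P' X else P X) ≠ P I₀ := by
      intro X hXq
      by_cases h : P X = P I₀
      · rw [if_pos h]; exact ⟨Or.inr rfl, fun h' => hPP' X (h.trans h'.symm)⟩
      · rw [if_neg h]; exact ⟨Or.inl rfl, h⟩
    rcases mem_union.1 hw with hw | hw
    · rw [hUC, mem_filter] at hw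
      obtain ⟨hwU, h1, -, -⟩ := hw
      have hXF := (hdata w hwU).2.1
      obtain ⟨-, -, -, -, -, -, ⟨hDF, hDē⟩, -, -, hon, -, -, -⟩ := facts w hwU
      obtain ⟨-, -, hIF, hIr, -, hXq, ha, hcold, -⟩ := hon h1
      refine ⟨hwU, hXF, hXq, hIF, hIr, ?_⟩
      rw [ha]
      exact ⟨hDF, hDē, hcold, ha ▸ hlast _ hXq⟩
    · rw [hUH, mem_filter] at hw
      obtain ⟨hwU, -, hcase⟩ := hw
      have hXF := (hdata w hwU).2.1
      obtain ⟨-, -, -, -, -, -, ⟨hDF, hDē⟩, ⟨hDeF, hDee⟩, hoff, hon, -, hbundle, -⟩ := facts w hwU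
      rcases hcase with ⟨h1, -⟩ | ⟨hn1, -, hb1, hb2⟩
      · obtain ⟨-, -, hIF, hIr, -, hXq, ha, hcold, -⟩ := hon h1
        refine ⟨hwU, hXF, hXq, hIF, hIr, ?_⟩
        rw [ha]
        exact ⟨hDF, hDē, hcold, ha ▸ hlast _ hXq⟩
      · obtain ⟨-, hIF, hIr, -, hXq, ha⟩ := hbundle ⟨hn1, hb1, hb2⟩
        obtain ⟨hJr, -, -⟩ := hoff hn1
        refine ⟨hwU, hXF, hXq, hIF, hIr, ?_⟩
        rw [ha]
        refine ⟨hDeF, hDee, ?_, ha ▸ hlast _ hXq⟩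
        rw [← hb2]; exact hJr
  have hA5 : ∀ T ∈ (((UC ∪ UH).image Prod.snd ×ˢ (UC ∪ UH).image Prod.snd).filter (fun p => p.1 < p.2)).image
      (fun p => ({p.1, p.2, I₀} : Finset ι)),
      ∃ X₁ X₂ : ι, (∃ w ∈ UC ∪ UH, w.2 = X₁) ∧ (∃ w ∈ UC ∪ UH, w.2 = X₂) ∧ X₁ ≠ X₂ ∧ T = {X₁, X₂, I₀} := by
    intro T hT
    obtain ⟨p, hp, rfl⟩ := mem_image.1 hT
    obtain ⟨hp, hlt⟩ := mem_filter.1 hp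
    obtain ⟨h1, h2⟩ := mem_product.1 hp
    obtain ⟨w₁, hw₁, hw₁X⟩ := mem_image.1 h1
    obtain ⟨w₂, hw₂, hw₂X⟩ := mem_image.1 h2
    exact ⟨p.1, p.2, ⟨w₁, hw₁, hw₁X⟩, ⟨w₂, hw₂, hw₂X⟩, ne_of_lt hlt, rfl⟩
  refine ⟨?_, ?_, ?_, ?_, ?_, ?_⟩ <;> refine disjoint_left.2 fun T hT1 hT2 => ?_
  · -- SELF vs SELF′
    obtain ⟨v, hv, hn1, -, -, rfl⟩ := hA2 T hT1
    obtain ⟨v', hv', hn1', ⟨⟨-, hIF, -⟩, hDI'⟩, hT⟩ := hA3 _ hT2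
    obtain ⟨-, -, -, -, -, -, ⟨hDF, -⟩, -, hoffv, -, -, -, -⟩ := facts v hv
    obtain ⟨-, hDr, hJI⟩ := hoffv hn1
    obtain ⟨heXv', hēXv', heēv', -, -, -, -, -, hoffv', -, -, -, -⟩ := facts v' hv'
    obtain ⟨hJr', -, -⟩ := hoffv' hn1'
    obtain ⟨-, hXFv, -, -, -, -, hJFv, -, -, -, -, hJēv, -, -⟩ := hdata v hv
    obtain ⟨-, hXFv', -, -, -, -, hJFv', -, -, -, hJev', -, -, -⟩ := hdata v' hv'
    have hI' : I₀ ∈ ({v.2, Jf v, dom v.2 (ēf v)} : Finset ι) := by rw [hT]; simp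
    have hJ : Jf v' ∈ ({v.2, Jf v, dom v.2 (ēf v)} : Finset ι) := by rw [hT]; simp
    have hX' : v'.2 ∈ ({v.2, Jf v, dom v.2 (ēf v)} : Finset ι) := by rw [hT]; simp
    simp only [mem_insert, mem_singleton] at hI' hJ hX'
    have hID : I₀ = dom v.2 (ēf v) := by
      rcases hI' with h | h | h
      · exact absurd (h ▸ hIF) hXFv
      · exact absurd h.symm hJI
      · exact h
    have hJJ : Jf v' = Jf v := by
      rcases hJ with h | h | h
      · exact absurd (h ▸ hJFv') hXFv
      · exact h
      · exfalso; rw [h] at hJr'; rcases hDr with h' | h'; exacts [hJr'.1 h', hJr'.2 h']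
    have hXX : v'.2 = v.2 := by
      rcases hX' with h | h | h
      · exact h
      · exact absurd (h ▸ hJFv) hXFv'
      · exact absurd (h ▸ hDF) hXFv'
    rw [hXX] at heXv' hēXv' hDI'
    rw [hJJ] at hJev'
    have hee : ef v' = ef v := by
      rcases hports v hv (ef v') heXv' with h | h
      · exact h
      · exact absurd (h ▸ hJev') hJēv
    have hēē : ēf v' = ēf v := by
      rcases hports v hv (ēf v') hēXv' with h | h
      · exact absurd (hee.trans h.symm) heēv'
      · exact h
    apply hDI'
    rw [hēē, ← hID]
  · -- SELF vs SELF_I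
    obtain ⟨v, hv, hn1, -, hnb, rfl⟩ := hA2 T hT1
    obtain ⟨w, hw, hT⟩ := mem_image.1 hT2
    obtain ⟨-, hXFw, -, hIF, hIr, hDhF, -, hDhr, haX, haq⟩ := hI w hw
    obtain ⟨-, -, -, -, hērv, -, ⟨hDF, hDē⟩, -, hoffv, -, -, -, -⟩ := facts v hv
    obtain ⟨-, hDr, hJI⟩ := hoffv hn1
    obtain ⟨-, hXFv, -, -, -, -, hJFv, -⟩ := hdata v hv
    have hI' : I₀ ∈ ({v.2, Jf v, dom v.2 (ēf v)} : Finset ι) := by rw [← hT]; simp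
    have hD' : dom w.2 (if P w.2 = P I₀ then P' w.2 else P w.2) ∈ ({v.2, Jf v, dom v.2 (ēf v)} : Finset ι) := by
      rw [← hT]; simp
    have hX' : w.2 ∈ ({v.2, Jf v, dom v.2 (ēf v)} : Finset ι) := by rw [← hT]; simp
    simp only [mem_insert, mem_singleton] at hI' hD' hX'
    have hID : I₀ = dom v.2 (ēf v) := by
      rcases hI' with h | h | h
      · exact absurd (h ▸ hIF) hXFv
      · exact absurd h.symm hJI
      · exact h
    have hDJ : dom w.2 (if P w.2 = P I₀ then P' w.2 else P w.2) = Jf v := by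
      rcases hD' with h | h | h
      · exact absurd (h ▸ hDhF) hXFv
      · exact h
      · exfalso; rw [h] at hDhr; rcases hDr with h' | h'; exacts [hDhr.1 h', hDhr.2 h']
    have hXX : w.2 = v.2 := by
      rcases hX' with h | h | h
      · exact h
      · exact absurd (h ▸ hJFv) hXFw
      · exact absurd (h ▸ hDF) hXFw
    rw [← hID] at hDē
    have hēq : ēf v = P I₀ := by
      rcases hDē with h | h
      · exact h.symm
      · exact absurd (h.symm.trans hIr) hērv
    rw [hXX] at hDJ haX haq
    have ha : (if P v.2 = P I₀ then P' v.2 else P v.2) = ef v := by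
      rcases hports v hv _ haX with h | h
      · exact h
      · exact absurd (h.trans hēq) haq
    rw [ha] at hDJ
    exact hnb ⟨by rw [← hID]; exact hIr, hDJ.symm⟩
  · -- SELF vs CROSS_I
    obtain ⟨v, hv, hn1, -, -, rfl⟩ := hA2 T hT1
    obtain ⟨X₁, X₂, ⟨w₁, hw₁, rfl⟩, ⟨w₂, hw₂, rfl⟩, -, hT⟩ := hA5 _ hT2
    obtain ⟨-, hXF₁, -⟩ := hI w₁ hw₁
    obtain ⟨-, hXF₂, -⟩ := hI w₂ hw₂
    obtain ⟨-, -, -, -, -, -, -, -, hoffv, -, -, -, -⟩ := facts v hv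
    obtain ⟨-, -, hJI⟩ := hoffv hn1
    obtain ⟨-, -, -, -, -, -, hJFv, -⟩ := hdata v hv
    have hJ : Jf v ∈ ({w₁.2, w₂.2, I₀} : Finset ι) := by rw [← hT]; simp
    simp only [mem_insert, mem_singleton] at hJ
    rcases hJ with h | h | h
    · exact hXF₁ (h ▸ hJFv)
    · exact hXF₂ (h ▸ hJFv)
    · exact hJI h
  · -- SELF′ vs SELF_I
    obtain ⟨v, hv, hn1, ⟨⟨hXqv, hIF, hIr⟩, hDIv⟩, rfl⟩ := hA3 T hT1
    obtain ⟨w, hw, hT⟩ := mem_image.1 hT2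
    obtain ⟨-, hXFw, -, -, -, hDhF, hDha, hDhr, haX, haq⟩ := hI w hw
    obtain ⟨-, hēXv, -, -, -, -, -, -, hoffv, -, -, -, hdomIv⟩ := facts v hv
    obtain ⟨-, hDr, -⟩ := hoffv hn1
    obtain ⟨-, hXFv, -, -, -, -, hJFv, -, -, -, -, hJēv, -, -⟩ := hdata v hv
    have hD' : dom w.2 (if P w.2 = P I₀ then P' w.2 else P w.2) ∈ ({v.2, Jf v, I₀} : Finset ι) := by rw [← hT]; simp
    have hX' : w.2 ∈ ({v.2, Jf v, I₀} : Finset ι) := by rw [← hT]; simp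
    simp only [mem_insert, mem_singleton] at hD' hX'
    have hDJ : dom w.2 (if P w.2 = P I₀ then P' w.2 else P w.2) = Jf v := by
      rcases hD' with h | h | h
      · exact absurd (h ▸ hDhF) hXFv
      · exact h
      · exfalso; rw [h] at hDhr; exact hDhr.2 hIr
    have hXX : w.2 = v.2 := by
      rcases hX' with h | h | h
      · exact h
      · exact absurd (h ▸ hJFv) hXFw
      · exact absurd (h ▸ hIF) hXFw
    rw [hXX] at hDJ hDha haX haq
    rw [hDJ] at hDha
    have ha : (if P v.2 = P I₀ then P' v.2 else P v.2) = ef v := by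
      rcases hports v hv _ haX with h | h
      · exact h
      · exact absurd (h ▸ hDha) hJēv
    rw [ha] at haq
    have hēq : ēf v = P I₀ := by
      rcases hports v hv (P I₀) hXqv with h | h
      · exact absurd h.symm haq
      · exact h.symm
    exact hDIv (hdomIv (ēf v) hēXv hēq hIF hIr hDr)
  · -- SELF′ vs CROSS_I
    obtain ⟨v, hv, hn1, -, rfl⟩ := hA3 T hT1
    obtain ⟨X₁, X₂, ⟨w₁, hw₁, rfl⟩, ⟨w₂, hw₂, rfl⟩, -, hT⟩ := hA5 _ hT2
    obtain ⟨-, hXF₁, -⟩ := hI w₁ hw₁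
    obtain ⟨-, hXF₂, -⟩ := hI w₂ hw₂
    obtain ⟨-, -, -, -, -, -, -, -, hoffv, -, -, -, -⟩ := facts v hv
    obtain ⟨-, -, hJI⟩ := hoffv hn1
    obtain ⟨-, -, -, -, -, -, hJFv, -⟩ := hdata v hv
    have hJ : Jf v ∈ ({w₁.2, w₂.2, I₀} : Finset ι) := by rw [← hT]; simp
    simp only [mem_insert, mem_singleton] at hJ
    rcases hJ with h | h | h
    · exact hXF₁ (h ▸ hJFv)
    · exact hXF₂ (h ▸ hJFv)
    · exact hJI h
  · -- SELF_I vs CROSS_I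
    obtain ⟨w, hw, rfl⟩ := mem_image.1 hT1
    obtain ⟨X₁, X₂, ⟨w₁, hw₁, rfl⟩, ⟨w₂, hw₂, rfl⟩, -, hT⟩ := hA5 _ hT2
    obtain ⟨-, -, -, -, hIr, hDhF, -, hDhr, -, -⟩ := hI w hw
    obtain ⟨-, hXF₁, -⟩ := hI w₁ hw₁
    obtain ⟨-, hXF₂, -⟩ := hI w₂ hw₂
    have hD : dom w.2 (if P w.2 = P I₀ then P' w.2 else P w.2) ∈ ({w₁.2, w₂.2, I₀} : Finset ι) := by rw [← hT]; simp
    simp only [mem_insert, mem_singleton] at hD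
    rcases hD with h | h | h
    · exact hXF₁ (h ▸ hDhF)
    · exact hXF₂ (h ▸ hDhF)
    · rw [h] at hDhr; exact hDhr.2 hIr

end StarSet

end Summit.CriticalPhenomena.PercolationContinuityZ3.Theorems
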